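/-
Copyright (c) 2026 the pub-hodgecm-mathlib formalisation cell (harness21).  Prover seat hodgecm-mathlib-F0P3a-p06 (g20); LH4-plan (g6) WORD #67 (T13-42 (4), price-list brick (P5b) «B1′»,
retiring M6 memo 544dfdf1cc8f9c98 §4 row «supplier B1»); 2026-09-02.
-/
import Literature.NumberTheory.Automorphic.UnitaryTwoIwahoriEdgeCountFibrewiseTypeTwo   -- ★ (R2-t2) FILE B1 (B-p08 (g28)): the type-(2) star value ∕ fibrewise edge count; brings ★ FILE A, ★ (R3b)(R3c)(R5a)
import Literature.NumberTheory.Automorphic.SelfDualLatticeAffineReductionTransport     -- ★ (P5a) «A′» (B-p08 (g40), p851749): (A1) `sub_smul_one_mul_self_eq_affine`, (A4) `glIntReduction_sub_smul_one_sq_eq_zero_of_affine`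
import HarnessLib

/-!
# The Iwahori edge count of an elliptic `γ ∈ U(1,1)` with an AFFINE square relation `(γ − a·1)² = f·(γ − a·1) + e·1`, `f, e ∈ 𝓂` — the type-(2) count with an EISENSTEIN CENTRE
# (Kottwitz 1988 §2; Serre, *Trees* II.1.1; the wild twin of ★ `UnitaryTwoIwahoriEdgeCountFibrewiseTypeTwo`)

Topic `NumberTheory/Automorphic`; namespace `Literature.NumberTheory.Automorphic`.  THEOREMS ONLY (no definition, no instance, no notation, no named fact, no `sorry`); kernel
lane `--kind proof --supports stmt-HodgeConjecture-24833`.  Cell `pub/hodgecm-mathlib`, crux H413 = `stmt-HodgeConjecture-24833`; line LH4 ((D-UNR)∕(D-RAM) price list, LEAD T13-42 (4));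
brick **(P5b) «B1′ — IWAHORI STAR COUNT WITH THE EISENSTEIN CENTRE»** (LH4-plan (g6) WORD #67), retiring M6 memo 544dfdf1cc8f9c98 §4 row «supplier B1» (B-p08 (g40)): at a WILD place the
square relation of a type-(2) elliptic element is no longer `(γ − a·1)² = e·1` with `a = tr γ∕2` (no `2⁻¹`!) but, for an INTEGRAL centre `a`, the affine `M² = f·M + e·1`, `M := γ − a·1`,
`f = tr γ − 2a ∈ 𝓂`, `e = −χ_γ(a) ∈ 𝓂` (memo §2(e): at the (W-unit) row `f = −2b∕ϖᵏ`, `e = b²w₀∕ϖ^{2k}`; the rows (T)∕(W-odd) have `f = 0`).  The star counts only need that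
the residual matrix `M̄` is NILPOTENT, and `M̄² = f̄ M̄ + ē = 0` still — so the two ★ counts of the type-(2) file hold VERBATIM under the affine hypothesis.  NO `h2`, no `tr∕2`
(★ `map_half_trace_mul_sub_one_eq (h2)` is not twinned: the centre `a ∈ 𝒪` and `|σ(a)a − 1| < 1` arrive as hypotheses).

* The REDUCTION STEP `(k − a·1)² = f·(k − a·1) + e·1`, `|f|, |e| < 1 ⇒ (k̄ − ā·1)² = 0` is ★ (A4) `glIntReduction_sub_smul_one_sq_eq_zero_of_affine` of the (P5a) file (imported, not restated).
* §1 `conj_sub_smul_one_affine` — conjugation inside `U(σ,J)` keeps the abstract affine relation `M² = f·M + e·1` (pure algebra, ★ `coe_conj_sub_smul_one`).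
* §2 **`natCard_fixedBy_unitaryTwo_star_of_sub_smul_one_affine`** (star value `1` off the scalar-reduction locus) and **`natCard_fixedBy_iwahori_eq_add_mul_of_sub_smul_one_affine`**
  (`#Fix_γ(U ⧸ I) = #Fix_γ(U ⧸ K) + s · #{x : k_x ≡ a·1 (mod 𝓂)}`) — CONCLUSIONS VERBATIM from ★ :121 ∕ :150 of the type-(2) file, hypothesis `hk`∕`hγ` re-keyed to the affine
  relation (binders `{a f e : F} (haO) (hfO) (heO) (hf) (he)`, the ★ shape with `f` added); census of the ★ proofs: :133 (`hsq :=` ★ FILE A ↦ ★ (A4)) and :191 (`hterm` else-branch)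
  RE-KEYED, every other line VERBATIM (same `maxHeartbeats 400000` for the `Finset.sum_ite` step); `sub_smul_one_mul_self_eq_affine_of_sq` — the `f = 0` case is the ★ hypothesis.
* §3 **`natCard_fixedBy_iwahori_eq_add_mul_of_trace_det`** — the CAYLEY–HAMILTON entry point (no `f, e` to supply): hypotheses `|tr γ − 2a| < 1`, `|a² − tr γ·a + det γ| < 1`
  (`a ∈ 𝒪`, `|σ(a)a − 1| < 1`), the affine relation being ★ (A1) `sub_smul_one_mul_self_eq_affine`; same conclusion.
HONEST LABEL: HC_CM is proved only modulo the 7 printed citations (2 remaining: hLiu418 = `stmt-HodgeConjecture-24832`, h413 = `stmt-HodgeConjecture-24833`) until rung 0 closes;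
count-neutral unconditional algebra ((D-UNR)∕(D-RAM) stay PRINT by D74′); pays no organ, opens no road.

## References
* [Kottwitz1988] R. E. Kottwitz, *Tamagawa numbers*, Ann. of Math. 127 (1988), 629–646, §2 Theorem 2 (fixed edges over fixed vertices).
* [Serre1980Trees] J.-P. Serre, *Trees* (1980), Ch. II §1.1.
* [IwahoriMatsumoto1965] N. Iwahori, H. Matsumoto, Publ. Math. IHÉS 25 (1965), §2 (reduction mod `𝔓` on `GL_n(𝒪)`).
* [Rogawski1990] J. D. Rogawski, *Automorphic Representations of Unitary Groups in Three Variables* (1990), §12.6 p. 174.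
* [Jacobowitz1962] R. Jacobowitz, *Hermitian forms over local fields*, Amer. J. Math. 84 (1962), §7 (dyadic unimodular hermitian lattices — the wild rows the affine centre serves).
-/

set_option autoImplicit false

noncomputable section

open Matrix ValuativeRel
open scoped ValuativeRel Matrix MatrixGroups

namespace Literature.NumberTheory.Automorphic

/-! ## §1 Conjugation keeps the affine relation -/

section Conj

variable {F : Type*} [Field F] (σ : F →+* F)

/-- **Conjugation keeps the affine square relation**: `(γ − a·1)² = f·(γ − a·1) + e·1` ⇒ the same for `y⁻¹γy` (`y⁻¹(γ − a·1)y = y⁻¹γy − a·1`, ★ `units_inv_mul_sub_smul_one_mul`).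
[cite: Kottwitz1988, §2] -/
theorem conj_sub_smul_one_affine {J : Matrix (Fin 2) (Fin 2) F} (γ y : ↥(unitaryGroupOfForm σ J)) {a f e : F}
    (hγ : ((((γ : ↥(unitaryGroupOfForm σ J)) : GL (Fin 2) F) : Matrix (Fin 2) (Fin 2) F) - a • (1 : Matrix (Fin 2) (Fin 2) F)) *
        ((((γ : ↥(unitaryGroupOfForm σ J)) : GL (Fin 2) F) : Matrix (Fin 2) (Fin 2) F) - a • (1 : Matrix (Fin 2) (Fin 2) F)) =
      f • ((((γ : ↥(unitaryGroupOfForm σ J)) : GL (Fin 2) F) : Matrix (Fin 2) (Fin 2) F) - a • (1 : Matrix (Fin 2) (Fin 2) F)) + e • (1 : Matrix (Fin 2) (Fin 2) F)) :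
    ((((y⁻¹ * γ * y : ↥(unitaryGroupOfForm σ J)) : GL (Fin 2) F) : Matrix (Fin 2) (Fin 2) F) - a • (1 : Matrix (Fin 2) (Fin 2) F)) *
        ((((y⁻¹ * γ * y : ↥(unitaryGroupOfForm σ J)) : GL (Fin 2) F) : Matrix (Fin 2) (Fin 2) F) - a • (1 : Matrix (Fin 2) (Fin 2) F)) =
      f • ((((y⁻¹ * γ * y : ↥(unitaryGroupOfForm σ J)) : GL (Fin 2) F) : Matrix (Fin 2) (Fin 2) F) - a • (1 : Matrix (Fin 2) (Fin 2) F)) +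
        e • (1 : Matrix (Fin 2) (Fin 2) F) := by
  have hcoe := coe_conj_sub_smul_one σ γ y a
  have hyy : (((y : ↥(unitaryGroupOfForm σ J)) : GL (Fin 2) F) : Matrix (Fin 2) (Fin 2) F) *
      ((((y : ↥(unitaryGroupOfForm σ J)) : GL (Fin 2) F)⁻¹ : GL (Fin 2) F) : Matrix (Fin 2) (Fin 2) F) = 1 := Units.mul_inv _
  rw [hcoe]
  set M := ((((γ : ↥(unitaryGroupOfForm σ J)) : GL (Fin 2) F) : Matrix (Fin 2) (Fin 2) F) - a • (1 : Matrix (Fin 2) (Fin 2) F)) with hM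
  set P := (((y : ↥(unitaryGroupOfForm σ J)) : GL (Fin 2) F) : Matrix (Fin 2) (Fin 2) F) with hP
  set Q := ((((y : ↥(unitaryGroupOfForm σ J)) : GL (Fin 2) F)⁻¹ : GL (Fin 2) F) : Matrix (Fin 2) (Fin 2) F) with hQ
  calc Q * M * P * (Q * M * P) = Q * (M * (P * Q) * M) * P := by simp only [Matrix.mul_assoc]
    _ = Q * (M * M) * P := by rw [hyy, Matrix.mul_one]
    _ = Q * (f • M + e • (1 : Matrix (Fin 2) (Fin 2) F)) * P := by rw [hγ]
    _ = f • (Q * M * P) + e • (1 : Matrix (Fin 2) (Fin 2) F) := by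
        rw [Matrix.mul_add, Matrix.add_mul, Matrix.mul_smul, Matrix.smul_mul, Matrix.mul_smul, Matrix.mul_one, Matrix.smul_mul, hQ, hP, Units.inv_mul]

end Conj

/-! ## §2 The type-(2) star value and the fibrewise edge count under the affine relation (★ :121 ∕ :150 with `hk`∕`hγ` re-keyed; conclusions verbatim) -/

section AffineTypeTwo

variable {F : Type*} [Field F] [ValuativeRel F] (σ : F →+* F) (σO : 𝒪[F] →+* 𝒪[F])
  (hσO' : ∀ x : 𝒪[F], ((σO x : 𝒪[F]) : F) = σ x) (hσσ : ∀ x, σO (σO x) = x) {a₀ : 𝒪[F]} (ha₀ : IsUnit (σO a₀ - a₀))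
  (τ : 𝓀[F] →+* 𝓀[F]) (hτ : ∀ x : 𝒪[F], IsLocalRing.residue 𝒪[F] (σO x) = τ (IsLocalRing.residue 𝒪[F] x))

include hσO' hσσ ha₀ hτ in
/-- **THE TYPE-(2) STAR VALUE WITH AN EISENSTEIN CENTRE** — for `k ∈ K = U(σ,Φ₂) ∩ GL₂(𝒪)` with the AFFINE relation `(k − a·1)² = f·(k − a·1) + e·1`, `a, f, e ∈ 𝒪`, `|f| < 1`,
`|e| < 1`, `|σ(a)·a − 1| < 1` and `k ≢ a·1 (mod 𝓂)`: the reduction `k̄` is a unitary TRANSVECTION with `τ(ā)ā = 1`, so exactly ONE isotropic point of `ℙ(𝓀²)` is `k̄`-fixed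
(★ (A4) + ★ `residue_mul_residue_eq_one` + ★ (R3b) `natCard_isotropic_fixed_eq_one_of_sq_eq_zero` through ★ (R3c) `natCard_fixedBy_unitaryTwo_star_eq`).  Twin of ★
`natCard_fixedBy_unitaryTwo_star_of_sq_eq_smul_one` (the case `f = 0`), conclusion VERBATIM. [cite: Kottwitz1988, §2] [cite: Serre1980Trees, Ch. II §1.1] -/
theorem natCard_fixedBy_unitaryTwo_star_of_sub_smul_one_affine [Finite 𝓀[F]] {J : Matrix (Fin 2) (Fin 2) F} (hJ : J = !![0, 1; 1, 0])
    (k : ↥((glInt 2 F).subgroupOf (unitaryGroupOfForm σ J))) {a f e : F} (haO : a ∈ 𝒪[F]) (hfO : f ∈ 𝒪[F]) (heO : e ∈ 𝒪[F])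
    (hf : valuation F f < 1) (he : valuation F e < 1)
    (hk : ((((k : ↥(unitaryGroupOfForm σ J)) : GL (Fin 2) F) : Matrix (Fin 2) (Fin 2) F) - a • (1 : Matrix (Fin 2) (Fin 2) F)) *
        ((((k : ↥(unitaryGroupOfForm σ J)) : GL (Fin 2) F) : Matrix (Fin 2) (Fin 2) F) - a • (1 : Matrix (Fin 2) (Fin 2) F)) =
      f • ((((k : ↥(unitaryGroupOfForm σ J)) : GL (Fin 2) F) : Matrix (Fin 2) (Fin 2) F) - a • (1 : Matrix (Fin 2) (Fin 2) F)) + e • (1 : Matrix (Fin 2) (Fin 2) F))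
    (hns : ¬ ∀ i j, valuation F ((((k : ↥(unitaryGroupOfForm σ J)) : GL (Fin 2) F) : Matrix (Fin 2) (Fin 2) F) i j -
      (a • (1 : Matrix (Fin 2) (Fin 2) F)) i j) < 1)
    (ha : valuation F (σ a * a - 1) < 1) :
    Nat.card (@MulAction.fixedBy _ (↥((glInt 2 F).subgroupOf (unitaryGroupOfForm σ J)) ⧸
        ((iwahoriGL 2 F).subgroupOf (unitaryGroupOfForm σ J)).subgroupOf ((glInt 2 F).subgroupOf (unitaryGroupOfForm σ J))) _
        (MulAction.quotient _ _) k) = 1 := by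
  rw [natCard_fixedBy_unitaryTwo_star_eq σ σO hσO' hσσ ha₀ τ hτ hJ k]
  have hM := transpose_map_glIntReduction_mul_antidiagTwo_mul σ σO hσO' τ hτ hJ k
  have hsq := glIntReduction_sub_smul_one_sq_eq_zero_of_affine (⟨((k : ↥(unitaryGroupOfForm σ J)) : GL (Fin 2) F), k.2⟩ : ↥(glInt 2 F)) ⟨a, haO⟩ ⟨f, hfO⟩ ⟨e, heO⟩ hf he hk
  have hl : τ (IsLocalRing.residue 𝒪[F] ⟨a, haO⟩) * IsLocalRing.residue 𝒪[F] ⟨a, haO⟩ = 1 := by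
    rw [← hτ]
    refine residue_mul_residue_eq_one (σO ⟨a, haO⟩) ⟨a, haO⟩ ?_
    rw [hσO']
    exact ha
  exact natCard_isotropic_fixed_eq_one_of_sq_eq_zero τ _ hM hsq (fun h => hns ((coe_glIntReduction_eq_smul_one_iff σ k ⟨a, haO⟩).1 h)) hl

include hσO' hσσ ha₀ hτ in
set_option maxHeartbeats 400000 in
/-- **THE TYPE-(2) FIBREWISE EDGE COUNT WITH AN EISENSTEIN CENTRE: `E(γ) = V(γ) + s · #{scalar-reduction vertices}`** (`s = #{t ∈ 𝓀 : τ t = −t}`): for `γ ∈ U(σ, Φ₂)` with the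
AFFINE relation `(γ − a·1)² = f·(γ − a·1) + e·1` (`a, f, e ∈ 𝒪`, `|f|, |e| < 1`, `|σ(a)a − 1| < 1`) and finitely many `γ`-fixed vertices, the `γ`-fixed edges number
`#Fix_γ(U ⧸ K) + s · #{x ∈ Fix_γ(U ⧸ K) : (out x)⁻¹ γ (out x) ≡ a·1 (mod 𝓂)}` — every local monodromy satisfies the same affine relation (`conj_sub_smul_one_affine`), so its star
count is `s + 1` (scalar, ★ `natCard_fixedBy_unitaryTwo_star_of_scalar`) or `1` (`natCard_fixedBy_unitaryTwo_star_of_sub_smul_one_affine`); sum by ★ `natCard_fixedBy_quotient_eq_sum_of_le`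
with the section `Quotient.out` — bookkeeping VERBATIM from ★ `natCard_fixedBy_iwahori_eq_add_mul_of_sq_eq_smul_one` (hence the same `maxHeartbeats 400000`).
[cite: Kottwitz1988, §2] [cite: Rogawski1990, §12.6 p. 174] -/
theorem natCard_fixedBy_iwahori_eq_add_mul_of_sub_smul_one_affine [Finite 𝓀[F]] {J : Matrix (Fin 2) (Fin 2) F} (hJ : J = !![0, 1; 1, 0])
    (γ : ↥(unitaryGroupOfForm σ J)) {a f e : F} (haO : a ∈ 𝒪[F]) (hfO : f ∈ 𝒪[F]) (heO : e ∈ 𝒪[F]) (hf : valuation F f < 1) (he : valuation F e < 1)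
    (hγ : ((((γ : ↥(unitaryGroupOfForm σ J)) : GL (Fin 2) F) : Matrix (Fin 2) (Fin 2) F) - a • (1 : Matrix (Fin 2) (Fin 2) F)) *
        ((((γ : ↥(unitaryGroupOfForm σ J)) : GL (Fin 2) F) : Matrix (Fin 2) (Fin 2) F) - a • (1 : Matrix (Fin 2) (Fin 2) F)) =
      f • ((((γ : ↥(unitaryGroupOfForm σ J)) : GL (Fin 2) F) : Matrix (Fin 2) (Fin 2) F) - a • (1 : Matrix (Fin 2) (Fin 2) F)) + e • (1 : Matrix (Fin 2) (Fin 2) F))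
    (ha : valuation F (σ a * a - 1) < 1)
    [Finite (MulAction.fixedBy (↥(unitaryGroupOfForm σ J) ⧸ (glInt 2 F).subgroupOf (unitaryGroupOfForm σ J)) γ)] :
    Nat.card (MulAction.fixedBy (↥(unitaryGroupOfForm σ J) ⧸ (iwahoriGL 2 F).subgroupOf (unitaryGroupOfForm σ J)) γ) =
      Nat.card (MulAction.fixedBy (↥(unitaryGroupOfForm σ J) ⧸ (glInt 2 F).subgroupOf (unitaryGroupOfForm σ J)) γ) +
        Nat.card {t : 𝓀[F] // τ t = -t} *
          Nat.card {x : MulAction.fixedBy (↥(unitaryGroupOfForm σ J) ⧸ (glInt 2 F).subgroupOf (unitaryGroupOfForm σ J)) γ //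
            ∀ i j, valuation F (((((x.1.out)⁻¹ * γ * x.1.out : ↥(unitaryGroupOfForm σ J)) : GL (Fin 2) F) : Matrix (Fin 2) (Fin 2) F) i j -
              (a • (1 : Matrix (Fin 2) (Fin 2) F)) i j) < 1} := by
  classical
  letI instK : MulAction (↥((glInt 2 F).subgroupOf (unitaryGroupOfForm σ J))) (↥((glInt 2 F).subgroupOf (unitaryGroupOfForm σ J)) ⧸
      ((iwahoriGL 2 F).subgroupOf (unitaryGroupOfForm σ J)).subgroupOf ((glInt 2 F).subgroupOf (unitaryGroupOfForm σ J))) :=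
    MulAction.quotient _ _
  letI : Fintype (MulAction.fixedBy (↥(unitaryGroupOfForm σ J) ⧸ (glInt 2 F).subgroupOf (unitaryGroupOfForm σ J)) γ) := Fintype.ofFinite _
  haveI hfinstar : Finite (↥((glInt 2 F).subgroupOf (unitaryGroupOfForm σ J)) ⧸
      ((iwahoriGL 2 F).subgroupOf (unitaryGroupOfForm σ J)).subgroupOf ((glInt 2 F).subgroupOf (unitaryGroupOfForm σ J))) := by
    apply Nat.finite_of_card_ne_zero
    rw [natCard_unitaryTwo_star σ σO hσO' hσσ ha₀ τ hτ hJ]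
    exact Nat.succ_ne_zero _
  set r : ↥(unitaryGroupOfForm σ J) ⧸ (glInt 2 F).subgroupOf (unitaryGroupOfForm σ J) → ↥(unitaryGroupOfForm σ J) := Quotient.out with hr'
  have hr : Function.RightInverse r QuotientGroup.mk := fun x => Quotient.out_eq x
  haveI : ∀ x : MulAction.fixedBy (↥(unitaryGroupOfForm σ J) ⧸ (glInt 2 F).subgroupOf (unitaryGroupOfForm σ J)) γ,
      Finite (MulAction.fixedBy (↥((glInt 2 F).subgroupOf (unitaryGroupOfForm σ J)) ⧸
        ((iwahoriGL 2 F).subgroupOf (unitaryGroupOfForm σ J)).subgroupOf ((glInt 2 F).subgroupOf (unitaryGroupOfForm σ J)))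
        (⟨(r x.1)⁻¹ * γ * r x.1, inv_mul_mul_mem_of_smul_eq r hr γ x.2⟩ : ↥((glInt 2 F).subgroupOf (unitaryGroupOfForm σ J)))) :=
    fun x => Subtype.finite
  rw [natCard_fixedBy_quotient_eq_sum_of_le (iwahori_subgroupOf_le σ J) r hr γ]
  -- the star count over each fixed vertex
  have hterm : ∀ x : MulAction.fixedBy (↥(unitaryGroupOfForm σ J) ⧸ (glInt 2 F).subgroupOf (unitaryGroupOfForm σ J)) γ,
      Nat.card (MulAction.fixedBy (↥((glInt 2 F).subgroupOf (unitaryGroupOfForm σ J)) ⧸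
        ((iwahoriGL 2 F).subgroupOf (unitaryGroupOfForm σ J)).subgroupOf ((glInt 2 F).subgroupOf (unitaryGroupOfForm σ J)))
        (⟨(r x.1)⁻¹ * γ * r x.1, inv_mul_mul_mem_of_smul_eq r hr γ x.2⟩ : ↥((glInt 2 F).subgroupOf (unitaryGroupOfForm σ J)))) =
      if ∀ i j, valuation F (((((x.1.out)⁻¹ * γ * x.1.out : ↥(unitaryGroupOfForm σ J)) : GL (Fin 2) F) : Matrix (Fin 2) (Fin 2) F) i j -
          (a • (1 : Matrix (Fin 2) (Fin 2) F)) i j) < 1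
        then Nat.card {t : 𝓀[F] // τ t = -t} + 1 else 1 := by
    intro x
    split_ifs with h
    · exact natCard_fixedBy_unitaryTwo_star_of_scalar σ σO hσO' hσσ ha₀ τ hτ hJ _ (a := ⟨a, haO⟩) h
    · exact natCard_fixedBy_unitaryTwo_star_of_sub_smul_one_affine σ σO hσO' hσσ ha₀ τ hτ hJ _ haO hfO heO hf he
        (conj_sub_smul_one_affine σ γ (r x.1) hγ) h ha
  simp_rw [hterm]
  rw [Finset.sum_ite, Finset.sum_const, Finset.sum_const, smul_eq_mul, smul_eq_mul, mul_one]
  have hV : Nat.card (MulAction.fixedBy (↥(unitaryGroupOfForm σ J) ⧸ (glInt 2 F).subgroupOf (unitaryGroupOfForm σ J)) γ) =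
      (Finset.univ : Finset (MulAction.fixedBy (↥(unitaryGroupOfForm σ J) ⧸ (glInt 2 F).subgroupOf (unitaryGroupOfForm σ J)) γ)).card := by
    rw [Nat.card_eq_fintype_card, Finset.card_univ]
  have hA : Nat.card {x : MulAction.fixedBy (↥(unitaryGroupOfForm σ J) ⧸ (glInt 2 F).subgroupOf (unitaryGroupOfForm σ J)) γ //
      ∀ i j, valuation F (((((x.1.out)⁻¹ * γ * x.1.out : ↥(unitaryGroupOfForm σ J)) : GL (Fin 2) F) : Matrix (Fin 2) (Fin 2) F) i j -
        (a • (1 : Matrix (Fin 2) (Fin 2) F)) i j) < 1} =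
      ((Finset.univ : Finset (MulAction.fixedBy (↥(unitaryGroupOfForm σ J) ⧸ (glInt 2 F).subgroupOf (unitaryGroupOfForm σ J)) γ)).filter fun x =>
        ∀ i j, valuation F (((((x.1.out)⁻¹ * γ * x.1.out : ↥(unitaryGroupOfForm σ J)) : GL (Fin 2) F) : Matrix (Fin 2) (Fin 2) F) i j -
          (a • (1 : Matrix (Fin 2) (Fin 2) F)) i j) < 1).card := by
    rw [Nat.card_eq_fintype_card, Fintype.card_subtype]
  rw [hV, hA, ← Finset.card_filter_add_card_filter_not
    (s := (Finset.univ : Finset (MulAction.fixedBy (↥(unitaryGroupOfForm σ J) ⧸ (glInt 2 F).subgroupOf (unitaryGroupOfForm σ J)) γ)))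
    (fun x => ∀ i j, valuation F (((((x.1.out)⁻¹ * γ * x.1.out : ↥(unitaryGroupOfForm σ J)) : GL (Fin 2) F) : Matrix (Fin 2) (Fin 2) F) i j -
      (a • (1 : Matrix (Fin 2) (Fin 2) F)) i j) < 1)]
  ring

omit [ValuativeRel F] in
/-- **The `f = 0` case is the ★ type-(2) count** (consistency): the affine hypothesis with `f = 0` is the square relation `(γ − a·1)² = e·1`. [cite: Kottwitz1988, §2] -/
theorem sub_smul_one_mul_self_eq_affine_of_sq {J : Matrix (Fin 2) (Fin 2) F} (γ : ↥(unitaryGroupOfForm σ J)) {a e : F}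
    (hγ : ((((γ : ↥(unitaryGroupOfForm σ J)) : GL (Fin 2) F) : Matrix (Fin 2) (Fin 2) F) - a • (1 : Matrix (Fin 2) (Fin 2) F)) *
        ((((γ : ↥(unitaryGroupOfForm σ J)) : GL (Fin 2) F) : Matrix (Fin 2) (Fin 2) F) - a • (1 : Matrix (Fin 2) (Fin 2) F)) = e • (1 : Matrix (Fin 2) (Fin 2) F)) :
    ((((γ : ↥(unitaryGroupOfForm σ J)) : GL (Fin 2) F) : Matrix (Fin 2) (Fin 2) F) - a • (1 : Matrix (Fin 2) (Fin 2) F)) *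
        ((((γ : ↥(unitaryGroupOfForm σ J)) : GL (Fin 2) F) : Matrix (Fin 2) (Fin 2) F) - a • (1 : Matrix (Fin 2) (Fin 2) F)) =
      (0 : F) • ((((γ : ↥(unitaryGroupOfForm σ J)) : GL (Fin 2) F) : Matrix (Fin 2) (Fin 2) F) - a • (1 : Matrix (Fin 2) (Fin 2) F)) + e • (1 : Matrix (Fin 2) (Fin 2) F) := by
  rw [hγ, zero_smul, zero_add]

include hσO' hσσ ha₀ hτ in
/-- **THE CAYLEY–HAMILTON ENTRY POINT** (no `f, e` to supply): for `γ ∈ U(σ, Φ₂)` and an integral centre `a` with `|tr γ − 2a| < 1`, `|a² − tr γ·a + det γ| < 1` and `|σ(a)a − 1| < 1`,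
the fibrewise edge count `E(γ) = V(γ) + s · #{scalar-reduction vertices}` holds — the affine relation `(γ − a·1)² = (tr γ − 2a)·(γ − a·1) − (a² − tr γ·a + det γ)·1` is ★ (A1)
`sub_smul_one_mul_self_eq_affine` (Cayley–Hamilton at the centre `a`).  At a wild (W-unit) row `tr γ − 2a = −2b∕ϖᵏ`, `a² − tr γ·a + det γ = −b²w₀∕ϖ^{2k}` (memo M6 §2(e)).
[cite: Kottwitz1988, §2] [cite: Rogawski1990, §12.6 p. 174] -/
theorem natCard_fixedBy_iwahori_eq_add_mul_of_trace_det [Finite 𝓀[F]] {J : Matrix (Fin 2) (Fin 2) F} (hJ : J = !![0, 1; 1, 0])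
    (γ : ↥(unitaryGroupOfForm σ J)) {a : F} (haO : a ∈ 𝒪[F])
    (htr : valuation F ((((γ : ↥(unitaryGroupOfForm σ J)) : GL (Fin 2) F) : Matrix (Fin 2) (Fin 2) F).trace - 2 * a) < 1)
    (hdet : valuation F (a * a - (((γ : ↥(unitaryGroupOfForm σ J)) : GL (Fin 2) F) : Matrix (Fin 2) (Fin 2) F).trace * a +
      (((γ : ↥(unitaryGroupOfForm σ J)) : GL (Fin 2) F) : Matrix (Fin 2) (Fin 2) F).det) < 1)
    (ha : valuation F (σ a * a - 1) < 1)
    [Finite (MulAction.fixedBy (↥(unitaryGroupOfForm σ J) ⧸ (glInt 2 F).subgroupOf (unitaryGroupOfForm σ J)) γ)] :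
    Nat.card (MulAction.fixedBy (↥(unitaryGroupOfForm σ J) ⧸ (iwahoriGL 2 F).subgroupOf (unitaryGroupOfForm σ J)) γ) =
      Nat.card (MulAction.fixedBy (↥(unitaryGroupOfForm σ J) ⧸ (glInt 2 F).subgroupOf (unitaryGroupOfForm σ J)) γ) +
        Nat.card {t : 𝓀[F] // τ t = -t} *
          Nat.card {x : MulAction.fixedBy (↥(unitaryGroupOfForm σ J) ⧸ (glInt 2 F).subgroupOf (unitaryGroupOfForm σ J)) γ //
            ∀ i j, valuation F (((((x.1.out)⁻¹ * γ * x.1.out : ↥(unitaryGroupOfForm σ J)) : GL (Fin 2) F) : Matrix (Fin 2) (Fin 2) F) i j -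
              (a • (1 : Matrix (Fin 2) (Fin 2) F)) i j) < 1} := by
  -- integrality of the two coefficients and of the matrix entries is not needed beyond `|·| < 1 ⇒ ∈ 𝒪`
  have hfO : (((γ : ↥(unitaryGroupOfForm σ J)) : GL (Fin 2) F) : Matrix (Fin 2) (Fin 2) F).trace - 2 * a ∈ 𝒪[F] :=
    (Valuation.mem_integer_iff _ _).2 (le_of_lt htr)
  have heO : -(a * a - (((γ : ↥(unitaryGroupOfForm σ J)) : GL (Fin 2) F) : Matrix (Fin 2) (Fin 2) F).trace * a +
      (((γ : ↥(unitaryGroupOfForm σ J)) : GL (Fin 2) F) : Matrix (Fin 2) (Fin 2) F).det) ∈ 𝒪[F] := by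
    refine (Valuation.mem_integer_iff _ _).2 ?_
    rw [Valuation.map_neg]
    exact le_of_lt hdet
  have he : valuation F (-(a * a - (((γ : ↥(unitaryGroupOfForm σ J)) : GL (Fin 2) F) : Matrix (Fin 2) (Fin 2) F).trace * a +
      (((γ : ↥(unitaryGroupOfForm σ J)) : GL (Fin 2) F) : Matrix (Fin 2) (Fin 2) F).det)) < 1 := by
    rw [Valuation.map_neg]
    exact hdet
  refine natCard_fixedBy_iwahori_eq_add_mul_of_sub_smul_one_affine σ σO hσO' hσσ ha₀ τ hτ hJ γ haO hfO heO htr he ?_ ha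
  rw [sub_smul_one_mul_self_eq_affine, neg_smul, sub_eq_add_neg]

end AffineTypeTwo

end Literature.NumberTheory.Automorphic

end
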